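import Summits.ResolutionOfSingularities.ResolutionOfSingularities.Theorems.PurelyInseparableDim4ChartAtlasSNCFarSideWPairs
import HarnessLib

/-!
# Purely inseparable four-folds `z^p + F(x₁, …, x₄)`: THE FAR SIDE OF S3-N2 ON `W` FOR EVERY `S'` — unconditional form for a pair-list boundary
# (cell `res-dim4-pi`, typ-2 g7; the `j ∈ S'` case has no far resonance at all, p699951 / p714892)

[OURS · counted 0] (D-0157 DOOR 2; DR-157-C.) p721014 (`farSide_globalCentre_pairs`) settles the escaping case `j ∉ S'`; for `j ∈ S'` the strict
transforms of the far members miss `Zc ⊆ E_j` (p699951), so p714892's `hasSNCWith_transform_boundary_globalCentre_of_mem_pairs` needs no height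
hypothesis. PROVED here (no `sorry`, no new axiom):

* **`farSide_globalCentre_pairs_every`** — for EVERY non-empty `S'` (pair-list boundary, `|B_near| ≤ 1`, NO height hypothesis): ∃ a nodup list `hs`
  of non-zero collision heights, EMPTY when `j ∈ S'`, with «`hs = []` → `HasSNCWith M′.boundary Zc`» and «`hs ≠ []` → the repair centre `C_W(hs)` is
  admissible for `M′` and after ANY blowing up of `W` along it `St(Zc)` is regular, inside the support, snc with the transformed boundary».

This is the far side of S3-N2 on `W` in ONE statement, in the currency of typ-3's entry point p714892. Nothing here is a statement about resolution
of singularities in dimension ≥ 4 / characteristic `p` (NOT proved anywhere in this programme). bears_on: LADDER-RESOLUTION:D157-DOOR2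
(res-dim4-pi). Supports stmt-ResolutionOfSingularities-16155 (helper).
-/

-- every declaration of this summit lives under `Summit.ResolutionOfSingularities.ResolutionOfSingularities`
-- (summit = problem), which the duplicate-namespace linter flags; house convention (cf. the Target file).
set_option linter.dupNamespace false

noncomputable section

open MvPolynomial CategoryTheory AlgebraicGeometry Opposite TopologicalSpace
open AlgebraicGeometry.Scheme.IdealSheafData (ofIdealTop vanishingIdeal)

namespace Summit.ResolutionOfSingularities.ResolutionOfSingularities.Theorems.PIDim4

open Literature.AlgebraicGeometry.Resolution
open Literature.AlgebraicGeometry.Resolution.Hauser2010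
open Literature.AlgebraicGeometry.Resolution.AffinePointBlowup (P A γ coord Wtop ξ)
open Literature.Barriers.ResolutionOfSingularities

namespace ChartDictionary

variable {K : Type} [Field K] {p : ℕ} [hp : Fact p.Prime] [CharP K p]
  {S S' : Finset (Fin 4)} {j : Fin 4} {b : Fin 4 → K} {Θⱼ : A 4 K ≃ₐ[K] A 4 K} {h : MvPolynomial (Fin 4) K}
  {F F₁ : MvPolynomial (Fin 4) K} {W : Scheme.{0}} {π : W ⟶ P 4 K}

/-- **THE FAR SIDE OF S3-N2 ON `W`, EVERY NON-EMPTY `S'`, PAIR-LIST BOUNDARY, NO HEIGHT HYPOTHESIS.** -/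
theorem farSide_globalCentre_pairs_every [IsAlgClosed K] (hj : j ∈ S) (hS' : S'.Nonempty) (hbj : b j = 0) (hF : F ≠ 0)
    (hclean : HauserPerlega.IsClean p F) (h0j : Θⱼ (X 0) = X 0 + rename Fin.succ h) (hsj : ∀ i : Fin 4, Θⱼ (X i.succ) = X i.succ + C (b i))
    (hπ : IsBlowup π (AffineCoordBlowup.𝓘Λ 4 K (insert 0 (Fin.succ '' (S : Set (Fin 4))))))
    (hperm : (p : ℕ∞) ≤ CentreBlowup.ordAlong S F)
    (hread : Θⱼ (coordBlowupSubst K (insert 0 (Fin.succ '' (S : Set (Fin 4)))) j.succ (hyp p F)) = X j.succ ^ p * hyp p F₁)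
    (hperm' : (p : ℕ∞) ≤ CentreBlowup.ordAlong S' F₁) (L : List (Fin 4 × K))
    (hB1 : (j, (0 : K)) ∈ L → ∀ mc ∈ L, mc.1 ∈ S → mc.1 ∈ S' → mc.2 = 0 → b mc.1 = 0)
    (hB2 : ∀ mc ∈ L, ∀ mc' ∈ L, mc.1 ∈ S → mc'.1 ∈ S → mc.1 ∈ S' → mc'.1 ∈ S' → mc.2 = 0 → mc'.2 = 0 → b mc.1 ≠ 0 → b mc'.1 ≠ 0 →
      mc.1 = mc'.1) :
    haveI : IsIso (CommRingCat.ofHom (Θⱼ : A 4 K →+* A 4 K)) := (inferInstance : IsIso Θⱼ.toRingEquiv.toCommRingCatIso.hom)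
    let φⱼ := Spec.map (CommRingCat.ofHom (Θⱼ : A 4 K →+* A 4 K)) ≫ AffineCoordBlowup.chartImm hπ (succ_mem_centreVars hj)
    let Zc := vanishingIdeal (closureImage φⱼ ((AffineCoordBlowup.𝓘Λ 4 K (insert 0 (Fin.succ '' (S' : Set (Fin 4))))).support : Set (P 4 K)))
    let M' := ((⟨hypSheaf p F, L.map fun ic => ofIdealTop (Ideal.span {(γ 4 K).symm (X ic.1.succ + C ic.2)}), p⟩ :
        MarkedIdeal (P 4 K)).transform π (AffineCoordBlowup.𝓘Λ 4 K (insert 0 (Fin.succ '' (S : Set (Fin 4))))))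
    ∃ hs : List K, hs.Nodup ∧ (∀ h' ∈ hs, h' ≠ 0) ∧ (j ∈ S' → hs = []) ∧ (hs = [] → HasSNCWith M'.boundary Zc) ∧
      (hs ≠ [] →
        let Cmod := (hs.map fun h' => (AffineCoordBlowup.𝓘Λ 4 K (insert 0 (Fin.succ '' ((insert j S' : Finset (Fin 4)) : Set (Fin 4))))).comap
          (Spec.map (CommRingCat.ofHom ((AffinePointBlowup.translateEquiv (n := 4) (Pi.single j.succ (-h')) : A 4 K ≃ₐ[K] A 4 K) :
            A 4 K →+* A 4 K)))).prod
        let CW := vanishingIdeal (closureImage φⱼ (Cmod.support : Set (P 4 K)))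
        (CW.comap φⱼ = Cmod ∧ (CW.support : Set W) ⊆ Set.range φⱼ ∧ (CW.support : Set W) ⊆ Zc.support ∧
            (CW.support : Set W) ⊆ M'.support ∧ Scheme.IsRegular CW.subscheme ∧ HasSNCWith M'.boundary CW) ∧
          ∀ ⦃W'' : Scheme.{0}⦄ ⦃τ : W'' ⟶ W⦄, IsBlowup τ CW →
            Scheme.IsRegular (strictTransformIdeal τ CW Zc).subscheme ∧
              ((strictTransformIdeal τ CW Zc).support : Set W'') ⊆ (M'.transform τ CW).support ∧
              HasSNCWith (M'.transform τ CW).boundary (strictTransformIdeal τ CW Zc)) := by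
  intro φⱼ Zc M'
  by_cases hjS' : j ∈ S'
  · -- inside `E_j`: no far resonance; no repair
    refine ⟨[], List.nodup_nil, fun _ h => by simp at h, fun _ => rfl, fun _ => ?_, fun h => absurd rfl h⟩
    exact hasSNCWith_transform_boundary_globalCentre_of_mem_pairs hj hjS' hbj hF hclean h0j hsj hπ hperm hread hperm' L hB1 hB2
  · obtain ⟨k₀, hk₀⟩ := hS'
    obtain ⟨hs, hnd, h0, hnil, hcons⟩ := farSide_globalCentre_pairs hj hjS' hbj hF hclean h0j hsj hπ hperm hread hperm' L hB1 hB2 hk₀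
    exact ⟨hs, hnd, h0, fun hj' => absurd hj' hjS', hnil, hcons⟩

end ChartDictionary

end Summit.ResolutionOfSingularities.ResolutionOfSingularities.Theorems.PIDim4

end
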